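import Literature.Analysis.FluidPDE.SelfSimilarEulerEnergyConcentration
import Literature.Analysis.FluidPDE.PutativeSelfSimilarEulerProofs
import HarnessLib

/-!
# Bronzi–Shvydkoy 2015, Lemma 2.1 (recovery of the self-similar pressure) and eq. (1.6) (the
# energy growth of the profile) for a locally self-similar Euler blow-up in the BKM class

Analysis/FluidPDE proof file (theorems only; no definitions, no named facts, no `sorry`) in the
story of `SelfSimilarEulerEnergyConcentration.lean` (the NAMED FACT
`bronziShvydkoy2015_energy_dichotomy` = A. Bronzi, R. Shvydkoy, Indiana Univ. Math. J. **64**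
(2015) = arXiv:1310.8611 [BronziShvydkoy2015], Thm 1.1).

BS15 §1 (held text p. 2): "in much of the literature the ansatz (1.3)
`u(x,t) = (T−t)^{−α/(1+α)} v((x−x₀)(T−t)^{−1/(1+α)})` is postulated along with the corresponding
pressure `p(x,t) = (T−t)^{−2α/(1+α)} q(·)` (1.4) in the same ball `B_{ρ₀}(x₀)`. While in globally
self-similar case this form of the pressure can be easily justified, in the local case it becomes
overdetermined as `p` is already recovered via (1.2). To resolve the problem we show in Lemma 2.1
that indeed (1.4) holds up to a time dependent constant `c(t)` … and the pair `(v,q)` solves (EE)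
in self-similar variables"; Lemma 2.1, Step 3 (p. 5): "Plugging the ansatz (1.3) into (EE) we see
that the expression `(T−t)^{(2α+1)/(α+1)} ∇p(x(T−t)^{1/(1+α)}, t)` is independent of time … the
members [of the family of rescaled pressures] differ pairwise by constants on their common domains
… This unambiguously defines the function `q(y)` … Thus
`p(x,t) = (T−t)^{−2α/(α+1)} q(x/(T−t)^{1/(α+1)}) + c(t)` for all `|x| ≤ ρ₀` … If we plug this back
into (EE) we recover (2.3) on the whole space."  And §1 (1.5)–(1.6): the finite energy of `u`
gives `∫_{|y|<L}|v|² ≲ L^{N−2α}`.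

This file proves exactly these two ELEMENTARY parts, for a classical Euler solution in the
Beale–Kato–Majda class of `NSVorticity.lean` (the class of the fact), with the profile only `C²`:

* `gradient_pressure_eq_of_locallySelfSimilar` — under the ansatz on `B_{ρ₀}(x₀) × [0,T)` the
  Euler momentum equation reads, at `x = x₀ + (T−t)^γ y`,
  `∇p(t,x) = −(T−t)^{γ−2} [(1−γ)v(y) + Dv(y)(γy + v(y))]`, `γ = 1/(α+1)` (BS15 Step 3, first
  sentence; the tree's `hasDerivAt_selfSimilarCollapse_time`, `fderiv_selfSimilarCollapse`);
* `exists_pressureProfile_of_locallySelfSimilar` — **BS15 Lemma 2.1 (elementary part)**: there is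
  a `C¹` (indeed smooth) `q : ℝ³ → ℝ` with `IsSelfSimilarEulerProfile (1/(α+1)) 0 v q` (the
  self-similar Euler system (2.3) on the WHOLE space) and
  `p(t,x) = (T−t)^{2(γ−1)} q((T−t)^{−γ}(x − x₀)) + p(t,x₀)` on `B_{ρ₀}(x₀) × [0,T)` — the rescaled
  pressures `Q_t(y) = (T−t)^{2(1−γ)}(p(t, x₀ + (T−t)^γ y) − p(t,x₀))` have gradient independent of
  `t` on the growing balls `|y| < ρ₀(T−t)^{−γ}` and vanish at `0`, hence patch to one function;
* `divFree_of_locallySelfSimilar` — `div v = 0`;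
* `energyGrowth_of_locallySelfSimilar` — **BS15 (1.5)–(1.6) = CS13 (1.3) in the BKM class**:
  `∫_{|y|<L}|v|² ≤ C L^{3−2α}` for `L ≥ L₀` (energy inequality
  `CIV2026.integrable_sq_norm_and_energy_le` + `energyGrowth_of_selfSimilarCollapse_energy_le`);
* `eq_zero_of_locallySelfSimilar_of_three_halves_lt` — CS13 §1 / BS15 §1: `α > 3/2` is excluded
  outright in the BKM class (`selfSimilarCollapse_profile_eq_zero_of_energy_le`);
* `bronziShvydkoy2015_energy_dichotomy.upper_bound` — the UPPER half of (1.8) is unconditional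
  (no shell-growth hypothesis, no appeal to the fact);
* `isSelfSimilarEulerProfile_linear`, `setIntegral_ball_normSq_linear`,
  `eq_zero_of_locallySelfSimilar_linear` — **BS15 (1.9)**: linear flows `v = My`,
  `q = −½⟨(M+M²)y,y⟩` (`tr M = 0`, `M + M²` symmetric) are exact profiles for EVERY exponent `γ`
  (the profile class is non-trivial for every `γ`), their energy scales like `L^{N+2}`, and hence
  ("they violate the energy bound (1.6)") a nonzero linear profile is never part of a locally
  self-similar blow-up in the BKM class, for any `α > −1`.

What is NOT here: the Calderón–Zygmund part of Lemma 2.1 (the singular-integral pressure `I(y)`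
of (2.2), the dyadic bound (2.4), temperedness of `q` via the weak-`L¹` bound on `p`, and
`q − I = const`), which is what the AMBIENT fact `bronziShvydkoy2015_energy_dichotomy` still needs
beyond `SelfSimilarEulerEnergyLowerBound.lean` (Thm 1.1 for `L^p` profiles). Use: every
PROFILE-level census hook of the tree (Chae–Shvydkoy Thm 3.2 / Cor 3.4, the `L^p` energy
dichotomy, the Constantin–Ignatova–Vicol far-field exclusions, all stated for
`IsSelfSimilarEulerProfile (1/(α+1)) 0 v q`) applies to an EXACT locally self-similar collapse
of a smooth finite-energy Euler solution WITHOUT a separate pressure ansatz — only integrability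
hypotheses on `(v, q)` remain to be checked by the user.

## Mathlib / tree search

`lean search 'pressureProfile|of_locallySelfSimilar|selfSimilarCollapsePressure'`: the tree has
the converse direction (`IsSelfSimilarEulerProfile.euler_selfSimilarCollapse`: a profile pair
generates an ansatz solution) and, on the Summits side, `isSelfSimilarEulerProfile_of_ns_selfSimilarCollapse`
(`FluidComputer/SelfSimilarCollapseViscousRigidity.lean`, which ASSUMES the pressure ansatz);
no recovery of the pressure profile from an ambient solution (2026-08-27). Reused:
`selfSimilarCollapse`, `hasDerivAt_selfSimilarCollapse_time`, `fderiv_selfSimilarCollapse`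
(`SelfSimilarCollapseAnsatz.lean`), `IsClassicalEulerSolutionOn` (`ClassicalSolution.lean`),
`CIV2026.integrable_sq_norm_and_energy_le` (`PutativeSelfSimilarEulerProofs.lean`),
`energyGrowth_of_selfSimilarCollapse_energy_le`, `selfSimilarCollapse_profile_eq_zero_of_energy_le`,
`setIntegral_norm_sq_selfSimilarCollapse_ball` (`SelfSimilarEulerLpExclusion.lean`); Mathlib
`Convex.is_const_of_fderivWithin_eq_zero`, `derivWithin_congr`, `fderiv_comp_sub`, `Filter.EventuallyEq.fderiv_eq`,
`HasFDerivAt.inner`, `Measure.setIntegral_comp_smul_of_pos`, `smul_unitBall`,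
`setIntegral_pos_iff_support_of_nonneg_ae`, `tendsto_rpow_neg_atTop`
(`lean search 'Profile_linear|linear_profile|isSelfSimilarEulerProfile_linear'`: no linear-profile
example in the tree, 2026-08-27).
No new definitions, no instances, no notation.

## References

* A. Bronzi, R. Shvydkoy, Indiana Univ. Math. J. 64 (2015) 1291–1302 = arXiv:1310.8611, §1
  eqs. (1.3)–(1.6), (1.9), §2 Lemma 2.1 (Step 3). [BronziShvydkoy2015]
* D. Chae, R. Shvydkoy, ARMA 209 (2013) = arXiv:1201.6009, §1 eqs. (1.2)–(1.3), §2.1 eq. (2.3).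
  [ChaeShvydkoy2013]
-/

noncomputable section

open MeasureTheory Set Filter Topology Metric InnerProductSpace
open scoped ENNReal NNReal Laplacian RealInnerProductSpace Pointwise

namespace Literature.Analysis.FluidPDE

/-! ## Scale bookkeeping -/

/-- `(T−t)^a (T−t)^b = (T−t)^{a+b}` for `t < T`. [folklore] -/
private theorem rpow_time_mul {T t : ℝ} (ht : t < T) (a b : ℝ) :
    (T - t) ^ a * (T - t) ^ b = (T - t) ^ (a + b) :=
  (Real.rpow_add (sub_pos.mpr ht) a b).symm

/-- The similarity point `x = x₀ + (T−t)^γ y` lies in `B_{ρ₀}(x₀)` iff `|y| < ρ₀ (T−t)^{−γ}`;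
here the direction used. [folklore] -/
private theorem mem_ball_of_mem_rescaledBall {γ T t ρ₀ : ℝ} (ht : t < T)
    {x₀ y : EuclideanSpace ℝ (Fin 3)}
    (hy : y ∈ ball (0 : EuclideanSpace ℝ (Fin 3)) (ρ₀ * (T - t) ^ (-γ))) :
    x₀ + (T - t) ^ γ • y ∈ ball x₀ ρ₀ := by
  have hs : 0 < T - t := sub_pos.mpr ht
  have hc : 0 < (T - t) ^ γ := Real.rpow_pos_of_pos hs _
  rw [mem_ball_zero_iff] at hy
  rw [mem_ball, dist_eq_norm, add_sub_cancel_left, norm_smul, Real.norm_of_nonneg hc.le]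
  calc (T - t) ^ γ * ‖y‖ < (T - t) ^ γ * (ρ₀ * (T - t) ^ (-γ)) := mul_lt_mul_of_pos_left hy hc
    _ = ρ₀ * ((T - t) ^ γ * (T - t) ^ (-γ)) := by ring
    _ = ρ₀ := by rw [rpow_time_mul ht, add_neg_cancel, Real.rpow_zero, mul_one]

/-- The similarity variable of `x = x₀ + (T−t)^γ y` is `y`. [folklore] -/
private theorem rescale_point {γ T t : ℝ} (ht : t < T) (x₀ y : EuclideanSpace ℝ (Fin 3)) :
    (T - t) ^ (-γ) • (x₀ + (T - t) ^ γ • y - x₀) = y := by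
  rw [add_sub_cancel_left, smul_smul, rpow_time_mul ht, neg_add_cancel, Real.rpow_zero, one_smul]

/-- The point of `B_{ρ₀}(x₀)` with similarity variable `y = (T−t)^{−γ}(x − x₀)`:
`x = x₀ + (T−t)^γ y` and `|y| < ρ₀ (T−t)^{−γ}`. [folklore] -/
private theorem mem_rescaledBall_of_mem_ball {γ T t ρ₀ : ℝ} (ht : t < T)
    {x₀ x : EuclideanSpace ℝ (Fin 3)} (hx : x ∈ ball x₀ ρ₀) :
    (T - t) ^ (-γ) • (x - x₀) ∈ ball (0 : EuclideanSpace ℝ (Fin 3)) (ρ₀ * (T - t) ^ (-γ)) ∧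
      x₀ + (T - t) ^ γ • ((T - t) ^ (-γ) • (x - x₀)) = x := by
  have hs : 0 < T - t := sub_pos.mpr ht
  have hc : 0 < (T - t) ^ (-γ) := Real.rpow_pos_of_pos hs _
  refine ⟨?_, ?_⟩
  · rw [mem_ball, dist_eq_norm] at hx
    rw [mem_ball_zero_iff, norm_smul, Real.norm_of_nonneg hc.le, mul_comm]
    exact mul_lt_mul_of_pos_right hx hc
  · rw [smul_smul, rpow_time_mul ht, add_neg_cancel, Real.rpow_zero, one_smul, add_sub_cancel]

/-! ## The momentum equation under the ansatz (BS15 Lemma 2.1, Step 3, first sentence) -/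

section Ansatz

variable {γ T ρ₀ : ℝ} {x₀ : EuclideanSpace ℝ (Fin 3)}
  {u : ℝ → EuclideanSpace ℝ (Fin 3) → EuclideanSpace ℝ (Fin 3)}
  {p : ℝ → EuclideanSpace ℝ (Fin 3) → ℝ}
  {v : EuclideanSpace ℝ (Fin 3) → EuclideanSpace ℝ (Fin 3)}

/-- **The velocity gradient of the ambient field under the local ansatz**: at `x ∈ B_{ρ₀}(x₀)`,
`D(u(t))(x) = (T−t)^{−1} Dv(y)`, `y = (T−t)^{−γ}(x − x₀)` (the ansatz holds on an open set, so the
Fréchet derivatives agree). [cite: BronziShvydkoy2015, §2 Lemma 2.1 (Step 3)] -/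
theorem fderiv_velocity_eq_of_locallySelfSimilar {t : ℝ} (ht : t < T)
    (hss : ∀ x ∈ ball x₀ ρ₀, u t x = selfSimilarCollapse γ T v t (x - x₀))
    {x : EuclideanSpace ℝ (Fin 3)} (hx : x ∈ ball x₀ ρ₀) :
    fderiv ℝ (u t) x = (T - t) ^ (-1 : ℝ) • fderiv ℝ v ((T - t) ^ (-γ) • (x - x₀)) := by
  -- `u t` agrees with the translated ansatz near `x`
  have hev : u t =ᶠ[𝓝 x] fun z => selfSimilarCollapse γ T v t (z - x₀) := by
    filter_upwards [isOpen_ball.mem_nhds hx] with z hz using hss z hz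
  rw [hev.fderiv_eq, fderiv_comp_sub x₀, fderiv_selfSimilarCollapse ht]

/-- **BS15 Lemma 2.1, Step 3, first sentence: the Euler momentum equation under the local
ansatz.** For a classical Euler solution `(u, p)` on `[0, T)` with
`u(t,x) = (T−t)^{γ−1} v((T−t)^{−γ}(x − x₀))` on `B_{ρ₀}(x₀) × [0,T)` (`v ∈ C¹`), at every
`t ∈ [0,T)` and `x ∈ B_{ρ₀}(x₀)`:
`∇p(t,x) = −(T−t)^{γ−2} [(1−γ) v(y) + Dv(y)(γ y + v(y))]`, `y = (T−t)^{−γ}(x − x₀)` — "the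
expression `(T−t)^{(2α+1)/(α+1)} ∇p(x (T−t)^{1/(1+α)}, t)` is independent of time" (note
`γ − 2 = −(2α+1)/(α+1)` for `γ = 1/(α+1)`). [cite: BronziShvydkoy2015, §2 Lemma 2.1 (Step 3)] -/
theorem gradient_pressure_eq_of_locallySelfSimilar (hsol : IsClassicalEulerSolutionOn (Ico 0 T) 0 u p)
    (hv : ContDiff ℝ 1 v)
    (hss : ∀ t ∈ Ico 0 T, ∀ x ∈ ball x₀ ρ₀, u t x = selfSimilarCollapse γ T v t (x - x₀))
    {t : ℝ} (ht : t ∈ Ico 0 T) {x : EuclideanSpace ℝ (Fin 3)} (hx : x ∈ ball x₀ ρ₀) :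
    gradient (p t) x =
      -((T - t) ^ (γ - 2) • ((1 - γ) • v ((T - t) ^ (-γ) • (x - x₀)) +
        fderiv ℝ v ((T - t) ^ (-γ) • (x - x₀))
          (γ • ((T - t) ^ (-γ) • (x - x₀)) + v ((T - t) ^ (-γ) • (x - x₀))))) := by
  have htT : t < T := ht.2
  set y : EuclideanSpace ℝ (Fin 3) := (T - t) ^ (-γ) • (x - x₀) with hy_def
  -- the momentum equation at `(t, x)`
  have hmom := hsol.momentum t ht x
  simp only [zero_smul, Pi.zero_apply, add_zero, zero_sub] at hmom
  -- the one-sided time derivative of `u` at `(t, x)` is that of the ansatz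
  have htime : timeDerivWithin (Ico 0 T) u t x =
      (T - t) ^ (γ - 2) • ((1 - γ) • v y + fderiv ℝ v y (γ • y)) := by
    rw [timeDerivWithin_apply]
    have hcongr : derivWithin (fun s => u s x) (Ico 0 T) t =
        derivWithin (fun s => selfSimilarCollapse γ T v s (x - x₀)) (Ico 0 T) t :=
      derivWithin_congr (fun s hs => hss s hs x hx) (hss t ht x hx)
    rw [hcongr]
    exact ((hasDerivAt_selfSimilarCollapse_time htT hv (x - x₀)).hasDerivWithinAt).derivWithin
      (uniqueDiffOn_Ico 0 T t ht)
  -- the convection term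
  have hconv : convect (u t) (u t) x = (T - t) ^ (γ - 2) • fderiv ℝ v y (v y) := by
    rw [convect, fderiv_velocity_eq_of_locallySelfSimilar htT (hss t ht) hx, hss t ht x hx,
      selfSimilarCollapse_apply, FunLike.coe_smul, Pi.smul_apply, map_smul, smul_smul,
      rpow_time_mul htT, show (-1 : ℝ) + (γ - 1) = γ - 2 by ring]
  rw [htime, hconv] at hmom
  -- solve for the pressure gradient
  have : gradient (p t) x = -((T - t) ^ (γ - 2) • ((1 - γ) • v y + fderiv ℝ v y (γ • y)) +
      (T - t) ^ (γ - 2) • fderiv ℝ v y (v y)) := neg_eq_iff_eq_neg.mp hmom.symm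
  rw [this, map_add, smul_add, smul_add, smul_add]
  abel

end Ansatz

/-! ## The rescaled pressures and their common gradient (BS15 Lemma 2.1, Step 3) -/

section Recovery

variable {γ T ρ₀ : ℝ} {x₀ : EuclideanSpace ℝ (Fin 3)}
  {u : ℝ → EuclideanSpace ℝ (Fin 3) → EuclideanSpace ℝ (Fin 3)}
  {p : ℝ → EuclideanSpace ℝ (Fin 3) → ℝ}
  {v : EuclideanSpace ℝ (Fin 3) → EuclideanSpace ℝ (Fin 3)}

/-- The rescaled pressure `y ↦ (T−t)^{2(1−γ)} (p(t, x₀ + (T−t)^γ y) − p(t, x₀))` is differentiable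
(the pressure slice is smooth). [folklore] -/
private theorem differentiable_rescaledPressure (hsol : IsClassicalEulerSolutionOn (Ico 0 T) 0 u p)
    {t : ℝ} (ht : t ∈ Ico 0 T) :
    Differentiable ℝ fun y : EuclideanSpace ℝ (Fin 3) =>
      (T - t) ^ (2 * (1 - γ)) * (p t (x₀ + (T - t) ^ γ • y) - p t x₀) := by
  have hp : Differentiable ℝ (p t) := (hsol.contDiff_pressure ht).differentiable (by simp)
  have hg : Differentiable ℝ fun y : EuclideanSpace ℝ (Fin 3) => x₀ + (T - t) ^ γ • y := by
    fun_prop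
  exact ((hp.comp hg).sub_const _).const_mul _

/-- **The gradient of the rescaled pressure is independent of time**: for `t ∈ [0,T)` and
`|y| < ρ₀(T−t)^{−γ}`, `D[(T−t)^{2(1−γ)}(p(t, x₀ + (T−t)^γ y) − p(t,x₀))](y) = ⟪−G(y), ·⟫` with
`G(y) = (1−γ)v(y) + Dv(y)(γy + v(y))` ("`(T−t)^{2α/(α+1)} ∇_y p̄(y,t)` is time independent on
the region `|y| ≤ ρ₀(T−t)^{−1/(1+α)}`"). [cite: BronziShvydkoy2015, §2 Lemma 2.1 (Step 3)] -/
theorem fderiv_rescaledPressure_eq_of_locallySelfSimilar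
    (hsol : IsClassicalEulerSolutionOn (Ico 0 T) 0 u p) (hv : ContDiff ℝ 1 v)
    (hss : ∀ t ∈ Ico 0 T, ∀ x ∈ ball x₀ ρ₀, u t x = selfSimilarCollapse γ T v t (x - x₀))
    {t : ℝ} (ht : t ∈ Ico 0 T) {y : EuclideanSpace ℝ (Fin 3)}
    (hy : y ∈ ball (0 : EuclideanSpace ℝ (Fin 3)) (ρ₀ * (T - t) ^ (-γ))) :
    fderiv ℝ (fun y : EuclideanSpace ℝ (Fin 3) =>
        (T - t) ^ (2 * (1 - γ)) * (p t (x₀ + (T - t) ^ γ • y) - p t x₀)) y =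
      InnerProductSpace.toDual ℝ (EuclideanSpace ℝ (Fin 3))
        (-((1 - γ) • v y + fderiv ℝ v y (γ • y + v y))) := by
  have htT : t < T := ht.2
  set x : EuclideanSpace ℝ (Fin 3) := x₀ + (T - t) ^ γ • y with hx_def
  have hx : x ∈ ball x₀ ρ₀ := mem_ball_of_mem_rescaledBall htT hy
  have hgrad := gradient_pressure_eq_of_locallySelfSimilar hsol hv hss ht hx
  rw [hx_def, rescale_point htT x₀ y, ← hx_def] at hgrad
  -- the chain rule for `y ↦ p t (x₀ + (T−t)^γ y)`
  have hp : Differentiable ℝ (p t) := (hsol.contDiff_pressure ht).differentiable (by simp)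
  have hg : HasFDerivAt (fun y : EuclideanSpace ℝ (Fin 3) => x₀ + (T - t) ^ γ • y)
      ((T - t) ^ γ • ContinuousLinearMap.id ℝ (EuclideanSpace ℝ (Fin 3))) y :=
    ((hasFDerivAt_id y).const_smul ((T - t) ^ γ)).const_add x₀
  have hcomp : HasFDerivAt (fun y : EuclideanSpace ℝ (Fin 3) => p t (x₀ + (T - t) ^ γ • y))
      ((fderiv ℝ (p t) x).comp ((T - t) ^ γ • ContinuousLinearMap.id ℝ (EuclideanSpace ℝ (Fin 3))))
      y := (hp x).hasFDerivAt.comp y hg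
  have hF : HasFDerivAt (fun y : EuclideanSpace ℝ (Fin 3) =>
      (T - t) ^ (2 * (1 - γ)) * (p t (x₀ + (T - t) ^ γ • y) - p t x₀))
      ((T - t) ^ (2 * (1 - γ)) • (fderiv ℝ (p t) x).comp
        ((T - t) ^ γ • ContinuousLinearMap.id ℝ (EuclideanSpace ℝ (Fin 3)))) y :=
    (hcomp.sub_const (p t x₀)).const_mul _
  rw [hF.fderiv, ContinuousLinearMap.comp_smul, ContinuousLinearMap.comp_id, smul_smul]
  -- `fderiv (p t) x = toDual (gradient (p t) x)`
  have hdual : fderiv ℝ (p t) x =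
      InnerProductSpace.toDual ℝ (EuclideanSpace ℝ (Fin 3)) (gradient (p t) x) := by
    rw [gradient, LinearIsometryEquiv.apply_symm_apply]
  rw [hdual, hgrad, ← map_smul, smul_neg, smul_smul, rpow_time_mul htT, rpow_time_mul htT,
    show 2 * (1 - γ) + γ + (γ - 2) = 0 by ring, Real.rpow_zero, one_smul]

/-- **The rescaled pressures agree on their common domains** ("the members differ pairwise by
constants on their common domains" — here they are normalised to vanish at `y = 0`, so they
coincide): for `s, t ∈ [0,T)` and `y` in both balls `|y| < ρ₀(T−s)^{−γ}`, `|y| < ρ₀(T−t)^{−γ}`.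
[cite: BronziShvydkoy2015, §2 Lemma 2.1 (Step 3)] -/
theorem rescaledPressure_eq_of_locallySelfSimilar
    (hsol : IsClassicalEulerSolutionOn (Ico 0 T) 0 u p) (hv : ContDiff ℝ 1 v)
    (hss : ∀ t ∈ Ico 0 T, ∀ x ∈ ball x₀ ρ₀, u t x = selfSimilarCollapse γ T v t (x - x₀))
    {s t : ℝ} (hs : s ∈ Ico 0 T) (ht : t ∈ Ico 0 T) {y : EuclideanSpace ℝ (Fin 3)}
    (hys : y ∈ ball (0 : EuclideanSpace ℝ (Fin 3)) (ρ₀ * (T - s) ^ (-γ)))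
    (hyt : y ∈ ball (0 : EuclideanSpace ℝ (Fin 3)) (ρ₀ * (T - t) ^ (-γ))) :
    (T - s) ^ (2 * (1 - γ)) * (p s (x₀ + (T - s) ^ γ • y) - p s x₀) =
      (T - t) ^ (2 * (1 - γ)) * (p t (x₀ + (T - t) ^ γ • y) - p t x₀) := by
  set Fs : EuclideanSpace ℝ (Fin 3) → ℝ := fun y =>
    (T - s) ^ (2 * (1 - γ)) * (p s (x₀ + (T - s) ^ γ • y) - p s x₀) with hFs_def
  set Ft : EuclideanSpace ℝ (Fin 3) → ℝ := fun y =>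
    (T - t) ^ (2 * (1 - γ)) * (p t (x₀ + (T - t) ^ γ • y) - p t x₀) with hFt_def
  have hFs : Differentiable ℝ Fs := differentiable_rescaledPressure hsol hs
  have hFt : Differentiable ℝ Ft := differentiable_rescaledPressure hsol ht
  -- the common domain: the smaller of the two balls
  set D : Set (EuclideanSpace ℝ (Fin 3)) :=
    ball (0 : EuclideanSpace ℝ (Fin 3)) (min (ρ₀ * (T - s) ^ (-γ)) (ρ₀ * (T - t) ^ (-γ))) with hD_def
  have hyD : y ∈ D := by
    rw [hD_def, mem_ball_zero_iff, lt_min_iff]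
    exact ⟨mem_ball_zero_iff.1 hys, mem_ball_zero_iff.1 hyt⟩
  have h0D : (0 : EuclideanSpace ℝ (Fin 3)) ∈ D := by
    rw [hD_def, mem_ball_zero_iff, norm_zero]
    exact lt_of_le_of_lt (norm_nonneg y) (mem_ball_zero_iff.1 hyD)
  have hDs : D ⊆ ball (0 : EuclideanSpace ℝ (Fin 3)) (ρ₀ * (T - s) ^ (-γ)) :=
    ball_subset_ball (min_le_left _ _)
  have hDt : D ⊆ ball (0 : EuclideanSpace ℝ (Fin 3)) (ρ₀ * (T - t) ^ (-γ)) :=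
    ball_subset_ball (min_le_right _ _)
  -- `Fs − Ft` has zero derivative on `D` and vanishes at `0`
  have hconst := (convex_ball (0 : EuclideanSpace ℝ (Fin 3)) _).is_const_of_fderivWithin_eq_zero
    (f := fun z => Fs z - Ft z) ((hFs.sub hFt).differentiableOn) (fun z hz => by
      rw [fderivWithin_of_isOpen isOpen_ball hz, fderiv_fun_sub (hFs z) (hFt z), hFs_def, hFt_def,
        fderiv_rescaledPressure_eq_of_locallySelfSimilar hsol hv hss hs (hDs hz),
        fderiv_rescaledPressure_eq_of_locallySelfSimilar hsol hv hss ht (hDt hz), sub_self]) h0D hyD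
  have h0 : Fs 0 - Ft 0 = 0 := by
    simp only [hFs_def, hFt_def, smul_zero, add_zero, sub_self, mul_zero]
  have := hconst.symm.trans h0
  exact sub_eq_zero.1 this

/-- **Every similarity variable is eventually inside the rescaled ball**: for `y ∈ ℝ³` there is
`t ∈ [0,T)` with `|y| < ρ₀ (T−t)^{−γ}` (`γ > 0`: the balls `|y| < ρ₀(T−t)^{−γ}` exhaust `ℝ³` as
`t ↑ T`; explicit choice `T − t = min(T, (ρ₀/(2(|y|+1)))^{1/γ})`). [folklore] -/
private theorem exists_mem_rescaledBall (hT : 0 < T) (hγ : 0 < γ) (hρ₀ : 0 < ρ₀)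
    (y : EuclideanSpace ℝ (Fin 3)) :
    ∃ t ∈ Ico 0 T, y ∈ ball (0 : EuclideanSpace ℝ (Fin 3)) (ρ₀ * (T - t) ^ (-γ)) := by
  set d : ℝ := ρ₀ / (2 * (‖y‖ + 1)) with hd_def
  have hn : 0 < ‖y‖ + 1 := by positivity
  have hd : 0 < d := by positivity
  set Dd : ℝ := d ^ (1 / γ) with hDd_def
  have hDd : 0 < Dd := Real.rpow_pos_of_pos hd _
  set m : ℝ := min T Dd with hm_def
  have hm : 0 < m := lt_min hT hDd
  have hmT : m ≤ T := min_le_left _ _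
  have hmD : m ≤ Dd := min_le_right _ _
  refine ⟨T - m, ⟨by linarith, by linarith⟩, ?_⟩
  rw [sub_sub_cancel, mem_ball_zero_iff]
  -- `m^γ ≤ d`
  have hmγ : m ^ γ ≤ d := by
    calc m ^ γ ≤ Dd ^ γ := Real.rpow_le_rpow hm.le hmD hγ.le
      _ = d := by rw [hDd_def, one_div, Real.rpow_inv_rpow hd.le hγ.ne']
  have hmγ0 : 0 < m ^ γ := Real.rpow_pos_of_pos hm _
  -- `‖y‖ m^γ < ρ₀`
  have hlt : ‖y‖ * m ^ γ < ρ₀ := by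
    have h1 : ‖y‖ * m ^ γ ≤ ‖y‖ * d := mul_le_mul_of_nonneg_left hmγ (norm_nonneg _)
    have h2 : ‖y‖ * d < ρ₀ := by
      rw [hd_def, mul_div_assoc', div_lt_iff₀ (by positivity)]
      nlinarith [norm_nonneg y]
    exact lt_of_le_of_lt h1 h2
  calc ‖y‖ = ‖y‖ * m ^ γ * m ^ (-γ) := by
        rw [mul_assoc, ← Real.rpow_add hm, add_neg_cancel, Real.rpow_zero, mul_one]
    _ < ρ₀ * m ^ (-γ) := mul_lt_mul_of_pos_right hlt (Real.rpow_pos_of_pos hm _)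

/-- **`div v = 0`** for the profile of a locally self-similar classical Euler solution
(`D u(t)(x) = (T−t)^{−1} Dv(y)` on the ball, and the balls exhaust `ℝ³`).
[cite: BronziShvydkoy2015, §2 Lemma 2.1 (Step 3) with eq. (2.3)] -/
theorem divFree_of_locallySelfSimilar (hT : 0 < T) (hγ : 0 < γ) (hρ₀ : 0 < ρ₀)
    (hsol : IsClassicalEulerSolutionOn (Ico 0 T) 0 u p)
    (hss : ∀ t ∈ Ico 0 T, ∀ x ∈ ball x₀ ρ₀, u t x = selfSimilarCollapse γ T v t (x - x₀)) :
    VectorCalculus.IsDivFree v := by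
  intro y
  obtain ⟨t, ht, hy⟩ := exists_mem_rescaledBall (T := T) (γ := γ) (ρ₀ := ρ₀) hT hγ hρ₀ y
  have htT : t < T := ht.2
  have hx : x₀ + (T - t) ^ γ • y ∈ ball x₀ ρ₀ := mem_ball_of_mem_rescaledBall htT hy
  have h0 := hsol.divFree t ht (x₀ + (T - t) ^ γ • y)
  unfold VectorCalculus.divergence at h0 ⊢
  rw [fderiv_velocity_eq_of_locallySelfSimilar htT (hss t ht) hx, rescale_point htT x₀ y,
    ContinuousLinearMap.toLinearMap_smul, map_smul, smul_eq_mul, mul_eq_zero] at h0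
  exact h0.resolve_left (Real.rpow_pos_of_pos (sub_pos.mpr htT) _).ne'

/-- **BS15 Lemma 2.1, Step 3 (recovery of the self-similar pressure): the profile pair solves
the self-similar Euler system on the whole space.** Let `(u, p)` be a classical Euler solution
on `ℝ³ × [0,T)`, `T > 0`, locally self-similar on `B_{ρ₀}(x₀) × [0,T)`:
`u(t,x) = (T−t)^{γ−1} v((T−t)^{−γ}(x − x₀))` with `γ > 0` and `v ∈ C²`. Then there is a `C¹`
function `q : ℝ³ → ℝ` such that `(v, q)` is a stationary self-similar Euler profile with exponent
`γ` centred at `0` (`IsSelfSimilarEulerProfile γ 0 v q`: `(1−γ)v + Dv(γy + v) + ∇q = 0`,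
`div v = 0` — BS15 (2.3) with `γ = 1/(1+α)`) AND the ambient pressure is self-similar up to a
time-dependent constant on the ball: `p(t,x) = (T−t)^{2(γ−1)} q((T−t)^{−γ}(x − x₀)) + p(t,x₀)`
for `t ∈ [0,T)`, `x ∈ B_{ρ₀}(x₀)` ("`p(x,t) = (T−t)^{−2α/(α+1)} q(x(T−t)^{−1/(α+1)}) + c(t)` for all
`|x| ≤ ρ₀`… If we plug this back into (EE) we recover (2.3) on the whole space"). The pressure
profile is obtained by patching the rescaled pressures `(T−t)^{2(1−γ)}(p(t, x₀+(T−t)^γ y) −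
p(t,x₀))` along the exhausting balls `|y| < ρ₀(T−t)^{−γ}`; no pressure ansatz is assumed.
[cite: BronziShvydkoy2015, §2 Lemma 2.1 (Step 3)] -/
theorem exists_pressureProfile_of_locallySelfSimilar (hT : 0 < T) (hγ : 0 < γ) (hρ₀ : 0 < ρ₀)
    (hsol : IsClassicalEulerSolutionOn (Ico 0 T) 0 u p) (hv : ContDiff ℝ 2 v)
    (hss : ∀ t ∈ Ico 0 T, ∀ x ∈ ball x₀ ρ₀, u t x = selfSimilarCollapse γ T v t (x - x₀)) :
    ∃ q : EuclideanSpace ℝ (Fin 3) → ℝ, IsSelfSimilarEulerProfile γ 0 v q ∧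
      ∀ t ∈ Ico 0 T, ∀ x ∈ ball x₀ ρ₀,
        p t x = (T - t) ^ (2 * (γ - 1)) * q ((T - t) ^ (-γ) • (x - x₀)) + p t x₀ := by
  have hv1 : ContDiff ℝ 1 v := hv.of_le one_le_two
  -- the rescaled pressures
  set F : ℝ → EuclideanSpace ℝ (Fin 3) → ℝ := fun t y =>
    (T - t) ^ (2 * (1 - γ)) * (p t (x₀ + (T - t) ^ γ • y) - p t x₀) with hF_def
  have hFsmooth : ∀ t ∈ Ico 0 T, ContDiff ℝ 1 (F t) := by
    intro t ht
    have hp : ContDiff ℝ 1 (p t) := (hsol.contDiff_pressure ht).of_le (by simp)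
    have hg : ContDiff ℝ 1 fun y : EuclideanSpace ℝ (Fin 3) => x₀ + (T - t) ^ γ • y := by
      fun_prop
    exact contDiff_const.mul ((hp.comp hg).sub contDiff_const)
  -- a time for every similarity variable
  choose τ hτ hτB using exists_mem_rescaledBall (T := T) (γ := γ) (ρ₀ := ρ₀) hT hγ hρ₀
  set q : EuclideanSpace ℝ (Fin 3) → ℝ := fun y => F (τ y) y with hq_def
  -- local representation of `q` by any rescaled pressure whose ball contains `y`
  have hloc : ∀ t ∈ Ico 0 T, ∀ y ∈ ball (0 : EuclideanSpace ℝ (Fin 3)) (ρ₀ * (T - t) ^ (-γ)),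
      q y = F t y := fun t ht y hy =>
    rescaledPressure_eq_of_locallySelfSimilar hsol hv1 hss (hτ y) ht (hτB y) hy
  have hev : ∀ t ∈ Ico 0 T, ∀ y ∈ ball (0 : EuclideanSpace ℝ (Fin 3)) (ρ₀ * (T - t) ^ (-γ)),
      q =ᶠ[𝓝 y] F t := fun t ht y hy => by
    filter_upwards [isOpen_ball.mem_nhds hy] with z hz using hloc t ht z hz
  -- `q` is `C¹` with `∇q = −G`
  have hq1 : ContDiff ℝ 1 q := contDiff_iff_contDiffAt.2 fun y =>
    ((hFsmooth (τ y) (hτ y)).contDiffAt).congr_of_eventuallyEq (hev (τ y) (hτ y) y (hτB y))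
  have hgrad : ∀ y, gradient q y = -((1 - γ) • v y + fderiv ℝ v y (γ • y + v y)) := by
    intro y
    rw [gradient, (hev (τ y) (hτ y) y (hτB y)).fderiv_eq, hF_def,
      fderiv_rescaledPressure_eq_of_locallySelfSimilar hsol hv1 hss (hτ y) (hτB y),
      LinearIsometryEquiv.symm_apply_apply]
  refine ⟨q, ⟨hv, hq1, fun y => ?_, divFree_of_locallySelfSimilar hT hγ hρ₀ hsol hss⟩,
    fun t ht x hx => ?_⟩
  · rw [sub_zero, hgrad y, add_neg_cancel]
  · -- the representation on the ball
    have htT : t < T := ht.2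
    obtain ⟨hyB, hxy⟩ := mem_rescaledBall_of_mem_ball (γ := γ) (ρ₀ := ρ₀) htT hx
    rw [hloc t ht _ hyB, hF_def]
    simp only
    rw [hxy, ← mul_assoc, rpow_time_mul htT, show 2 * (γ - 1) + 2 * (1 - γ) = 0 by ring,
      Real.rpow_zero, one_mul, sub_add_cancel]

end Recovery

/-! ## BS15 (1.5)–(1.6): the energy growth of the profile in the BKM class -/

section Energy

variable {γ α T ρ₀ : ℝ} {x₀ : EuclideanSpace ℝ (Fin 3)}
  {u : ℝ → EuclideanSpace ℝ (Fin 3) → EuclideanSpace ℝ (Fin 3)}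
  {p : ℝ → EuclideanSpace ℝ (Fin 3) → ℝ}
  {v : EuclideanSpace ℝ (Fin 3) → EuclideanSpace ℝ (Fin 3)}

/-- Translating a ball integral: `∫_{B_ρ(x₀)} f(x − x₀) dx = ∫_{B_ρ(0)} f(z) dz`. [folklore] -/
private theorem setIntegral_comp_sub_ball' (f : EuclideanSpace ℝ (Fin 3) → ℝ)
    (x₀ : EuclideanSpace ℝ (Fin 3)) (ρ : ℝ) :
    ∫ x in ball x₀ ρ, f (x - x₀) = ∫ z in ball (0 : EuclideanSpace ℝ (Fin 3)) ρ, f z := by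
  rw [← integral_indicator measurableSet_ball, ← integral_indicator measurableSet_ball]
  have hind : (ball x₀ ρ).indicator (fun x => f (x - x₀)) =
      fun x => (ball (0 : EuclideanSpace ℝ (Fin 3)) ρ).indicator f (x - x₀) := by
    funext x
    have hmem : x ∈ ball x₀ ρ ↔ x - x₀ ∈ ball (0 : EuclideanSpace ℝ (Fin 3)) ρ := by
      rw [mem_ball, mem_ball, dist_eq_norm, dist_zero_right]
    by_cases hx : x ∈ ball x₀ ρ
    · rw [indicator_of_mem hx, indicator_of_mem (hmem.1 hx)]
    · rw [indicator_of_notMem hx, indicator_of_notMem (fun h => hx (hmem.2 h))]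
  rw [hind]
  exact integral_sub_right_eq_self _ x₀

/-- **BS15 (1.5): the local energy of the ansatz is bounded by the (non-increasing) total
energy** — `‖u(t)‖²_{L²(B_{ρ₀}(x₀))} ≤ ‖u(t)‖²_{L²} ≤ ‖u(0)‖²_{L²}` for a classical Euler solution in
the Beale–Kato–Majda class on `[0,T)` (energy inequality
`CIV2026.integrable_sq_norm_and_energy_le`), written for the ansatz on the centred ball.
[cite: BronziShvydkoy2015, §1 eqs. (1.5)–(1.6)] -/
theorem ansatz_ball_energy_le_of_locallySelfSimilar
    (hsol : IsClassicalEulerSolutionOn (Ico 0 T) 0 u p)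
    (hreg : ∀ T'' < T, HasBoundedSobolevNormsOn (Icc 0 T'') u)
    (hss : ∀ t ∈ Ico 0 T, ∀ x ∈ ball x₀ ρ₀, u t x = selfSimilarCollapse γ T v t (x - x₀))
    {t : ℝ} (ht : t ∈ Ico 0 T) :
    ∫ z in ball (0 : EuclideanSpace ℝ (Fin 3)) ρ₀, ‖selfSimilarCollapse γ T v t z‖ ^ 2 ≤
      ∫ x, ‖u 0 x‖ ^ 2 := by
  obtain ⟨hint, hle⟩ := CIV2026.integrable_sq_norm_and_energy_le hsol hreg ht
  rw [← setIntegral_comp_sub_ball' (fun z => ‖selfSimilarCollapse γ T v t z‖ ^ 2) x₀ ρ₀]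
  calc ∫ x in ball x₀ ρ₀, ‖selfSimilarCollapse γ T v t (x - x₀)‖ ^ 2
      = ∫ x in ball x₀ ρ₀, ‖u t x‖ ^ 2 :=
        setIntegral_congr_fun measurableSet_ball fun x hx => by rw [hss t ht x hx]
    _ ≤ ∫ x, ‖u t x‖ ^ 2 := setIntegral_le_integral hint (ae_of_all _ fun x => by positivity)
    _ ≤ ∫ x, ‖u 0 x‖ ^ 2 := hle

/-- **BS15 (1.6) = CS13 (1.3) in the BKM class: the energy growth of the profile.** For a
classical Euler solution in the Beale–Kato–Majda class on `[0,T)`, locally self-similar on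
`B_{ρ₀}(x₀) × [0,T)` with exponent `γ = 1/(α+1)`, `α > −1`, the profile satisfies
`∫_{|y|<L} |v|² ≤ ‖u(0)‖²_{L²} ρ₀^{2α−3} L^{3−2α}` for `L ≥ ρ₀ T^{−1/(α+1)}` ("the conservation of
total energy … implies the bound `∫_{|y|<L}|v|² ≲ L^{N−2α}`").
[cite: BronziShvydkoy2015, §1 eqs. (1.5)–(1.6); ChaeShvydkoy2013, §1 eq. (1.3)] -/
theorem energyGrowth_of_locallySelfSimilar (hT : 0 < T) (hα : -1 < α) (hρ₀ : 0 < ρ₀)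
    (hsol : IsClassicalEulerSolutionOn (Ico 0 T) 0 u p)
    (hreg : ∀ T'' < T, HasBoundedSobolevNormsOn (Icc 0 T'') u)
    (hss : ∀ t ∈ Ico 0 T, ∀ x ∈ ball x₀ ρ₀,
      u t x = selfSimilarCollapse (1 / (α + 1)) T v t (x - x₀))
    {L : ℝ} (hL : ρ₀ * T ^ (-(1 / (α + 1))) ≤ L) :
    ∫ y in ball (0 : EuclideanSpace ℝ (Fin 3)) L, ‖v y‖ ^ 2 ≤
      (∫ x, ‖u 0 x‖ ^ 2) * ρ₀ ^ (2 * α - 3) * L ^ (3 - 2 * α) :=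
  energyGrowth_of_selfSimilarCollapse_energy_le (t₀ := 0) (E₀ := ∫ x, ‖u 0 x‖ ^ 2) hα hT hρ₀ v
    (fun _ ht => ansatz_ball_energy_le_of_locallySelfSimilar hsol hreg hss ht) (by rwa [sub_zero])

/-- **The range `α > 3/2` is excluded outright in the BKM class** (CS13 §1: "the case `α > N/2`
is automatically excluded"; BS15 Thm 1.1 assumes `α < N/2`): a classical Euler solution in the
Beale–Kato–Majda class on `[0,T)` that is locally self-similar with a continuous profile and
exponent `γ = 1/(α+1)`, `α > 3/2`, has the trivial profile.
[cite: ChaeShvydkoy2013, §1 eq. (1.3) and §2.3 Cor. 2.2; BronziShvydkoy2015, §1 Thm. 1.1] -/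
theorem eq_zero_of_locallySelfSimilar_of_three_halves_lt (hT : 0 < T) (hα : 3 / 2 < α)
    (hρ₀ : 0 < ρ₀) (hsol : IsClassicalEulerSolutionOn (Ico 0 T) 0 u p)
    (hreg : ∀ T'' < T, HasBoundedSobolevNormsOn (Icc 0 T'') u) (hv : Continuous v)
    (hss : ∀ t ∈ Ico 0 T, ∀ x ∈ ball x₀ ρ₀,
      u t x = selfSimilarCollapse (1 / (α + 1)) T v t (x - x₀)) :
    v = 0 :=
  selfSimilarCollapse_profile_eq_zero_of_energy_le (t₀ := 0) (E₀ := ∫ x, ‖u 0 x‖ ^ 2) hα hT hρ₀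
    hv fun _ ht => ansatz_ball_energy_le_of_locallySelfSimilar hsol hreg hss ht

end Energy

/-! ## Packaging in the binder shape of `bronziShvydkoy2015_energy_dichotomy` -/

/-- **BS15 Lemma 2.1 (elementary part) + (1.6) in the binder shape of the fact
`bronziShvydkoy2015_energy_dichotomy`.** For `T > 0`, `α > −1`, `ρ₀ > 0`, a classical Euler
solution `(u, p)` on `ℝ³ × [0,T)` in the Beale–Kato–Majda class, locally self-similar on
`B_{ρ₀}(x₀) × [0,T)` with a `C²` profile `v`, there is a pressure profile `q` with:
(i) `(v, q)` is a stationary self-similar Euler profile with exponent `1/(α+1)` (BS15 (2.3)) —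
so every profile-level statement of the tree (Chae–Shvydkoy Thm 3.2 / Cor 3.4, the `L^p` energy
dichotomy of `SelfSimilarEulerEnergyLowerBound.lean`, the Constantin–Ignatova–Vicol far-field
exclusions) applies to it; (ii) `p(t,x) = (T−t)^{2(γ−1)} q((T−t)^{−γ}(x−x₀)) + p(t,x₀)` on the ball,
`γ = 1/(α+1)` (so `2(γ−1) = −2α/(α+1)`); (iii) `∫_{|y|<L}|v|² ≤ ‖u(0)‖²_{L²} ρ₀^{2α−3} L^{3−2α}`
for `L ≥ ρ₀ T^{−γ}` (the upper half of (1.8), unconditional).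
[cite: BronziShvydkoy2015, §1 eqs. (1.3)–(1.6) and §2 Lemma 2.1 (Step 3)] -/
theorem bronziShvydkoy2015_profile_of_locallySelfSimilar (T α ρ₀ : ℝ)
    (x₀ : EuclideanSpace ℝ (Fin 3))
    (u : ℝ → EuclideanSpace ℝ (Fin 3) → EuclideanSpace ℝ (Fin 3))
    (p : ℝ → EuclideanSpace ℝ (Fin 3) → ℝ)
    (v : EuclideanSpace ℝ (Fin 3) → EuclideanSpace ℝ (Fin 3))
    (hT : 0 < T) (hα : -1 < α) (hρ₀ : 0 < ρ₀)
    (hsol : IsClassicalEulerSolutionOn (Ico 0 T) 0 u p)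
    (hreg : ∀ T'' < T, HasBoundedSobolevNormsOn (Icc 0 T'') u)
    (hv : ContDiff ℝ 2 v)
    (hss : ∀ t ∈ Ico 0 T, ∀ x ∈ ball x₀ ρ₀,
      u t x = selfSimilarCollapse (1 / (α + 1)) T v t (x - x₀)) :
    ∃ q : EuclideanSpace ℝ (Fin 3) → ℝ, IsSelfSimilarEulerProfile (1 / (α + 1)) 0 v q ∧
      (∀ t ∈ Ico 0 T, ∀ x ∈ ball x₀ ρ₀,
        p t x = (T - t) ^ (2 * (1 / (α + 1) - 1)) * q ((T - t) ^ (-(1 / (α + 1))) • (x - x₀)) +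
          p t x₀) ∧
      ∀ L : ℝ, ρ₀ * T ^ (-(1 / (α + 1))) ≤ L →
        ∫ y in ball (0 : EuclideanSpace ℝ (Fin 3)) L, ‖v y‖ ^ 2 ≤
          (∫ x, ‖u 0 x‖ ^ 2) * ρ₀ ^ (2 * α - 3) * L ^ (3 - 2 * α) := by
  have hγ : 0 < 1 / (α + 1) := by
    have : 0 < α + 1 := by linarith
    positivity
  obtain ⟨q, hprof, hrep⟩ := exists_pressureProfile_of_locallySelfSimilar hT hγ hρ₀ hsol hv hss
  exact ⟨q, hprof, hrep, fun L hL => energyGrowth_of_locallySelfSimilar hT hα hρ₀ hsol hreg hss hL⟩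

/-- **The upper half of BS15 (1.8) is unconditional** (relative form for users of the fact): under
the hypotheses of `bronziShvydkoy2015_energy_dichotomy` except the shell-growth bound (1.7) and
`α < 3/2` — indeed for every `α > −1` — `∫_{|y|<L}|v|² ≤ C L^{3−2α}` for all `L ≥ L₀`, some
`L₀ > 0` ("the upper bound in (1.8) is simply a consequence of the fact that `v` is a part of the
solution `u` with finite energy"). [cite: BronziShvydkoy2015, §1 Thm. 1.1 (upper bound in (1.8))] -/
theorem bronziShvydkoy2015_energy_dichotomy.upper_bound {T α ρ₀ : ℝ}
    {x₀ : EuclideanSpace ℝ (Fin 3)}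
    {u : ℝ → EuclideanSpace ℝ (Fin 3) → EuclideanSpace ℝ (Fin 3)}
    {p : ℝ → EuclideanSpace ℝ (Fin 3) → ℝ}
    {v : EuclideanSpace ℝ (Fin 3) → EuclideanSpace ℝ (Fin 3)}
    (hT : 0 < T) (hα : -1 < α) (hρ₀ : 0 < ρ₀)
    (hsol : IsClassicalEulerSolutionOn (Ico 0 T) 0 u p)
    (hreg : ∀ T'' < T, HasBoundedSobolevNormsOn (Icc 0 T'') u)
    (hss : ∀ t ∈ Ico 0 T, ∀ x ∈ ball x₀ ρ₀,
      u t x = selfSimilarCollapse (1 / (α + 1)) T v t (x - x₀)) :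
    ∃ C L₀ : ℝ, 0 < L₀ ∧ ∀ L : ℝ, L₀ ≤ L →
      ∫ y in ball (0 : EuclideanSpace ℝ (Fin 3)) L, ‖v y‖ ^ 2 ≤ C * L ^ (3 - 2 * α) :=
  ⟨(∫ x, ‖u 0 x‖ ^ 2) * ρ₀ ^ (2 * α - 3), ρ₀ * T ^ (-(1 / (α + 1))),
    mul_pos hρ₀ (Real.rpow_pos_of_pos hT _),
    fun _ hL => energyGrowth_of_locallySelfSimilar hT hα hρ₀ hsol hreg hss hL⟩

/-! ### BS15 (1.9): linear profiles exist for every exponent and violate the energy bound -/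

section LinearProfiles

variable {E : Type*} [NormedAddCommGroup E] [InnerProductSpace ℝ E] [FiniteDimensional ℝ E]

/-- **BS15 (1.9): linear flows are exact self-similar profiles, for every exponent.** For a
continuous linear map `M` with `tr M = 0` and `M + M²` symmetric, the pair `v(y) = M y`,
`q(y) = −½⟪(M + M²) y, y⟫` satisfies the stationary self-similar Euler profile equation
`(1 − γ) v + ((γ y + v)·∇) v + ∇q = 0`, `div v = 0` for EVERY `γ` ("linear solutions to (2.3)
are self-similar in their own sense … `v(y) = My`, `q(y) = −½⟨(M + M²)y, y⟩`, `tr M = 0`,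
`M + M² ∈ Sym_N`"): indeed `∇q = −(M + M²)y`, `Dv = M`, so the left side is
`(1−γ)My + γMy + M²y − My − M²y = 0`. In particular the profile class `IsSelfSimilarEulerProfile γ 0`
is non-trivial for every `γ` (with infinite energy, `isSelfSimilarEulerProfile_linear_energy`), so
the energy / integrability hypotheses of the Chae–Shvydkoy and Bronzi–Shvydkoy exclusions cannot
be dropped. Stated on any finite-dimensional real inner product space.
[cite: BronziShvydkoy2015, §1 eq. (1.9)] -/
theorem isSelfSimilarEulerProfile_linear (γ : ℝ) (M : E →L[ℝ] E)
    (htr : LinearMap.trace ℝ E (M : E →ₗ[ℝ] E) = 0)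
    (hsymm : ∀ y z : E, ⟪(M + M.comp M) y, z⟫ = ⟪y, (M + M.comp M) z⟫) :
    IsSelfSimilarEulerProfile γ 0 (fun y => M y)
      (fun y => -(1 / 2 : ℝ) * ⟪(M + M.comp M) y, y⟫) := by
  set S : E →L[ℝ] E := M + M.comp M with hS_def
  have hgrad : ∀ y, HasGradientAt (fun y : E => -(1 / 2 : ℝ) * ⟪S y, y⟫) (-(S y)) y := by
    intro y
    rw [hasGradientAt_iff_hasFDerivAt]
    have h1 : HasFDerivAt (fun y : E => ⟪S y, y⟫)
        ((fderivInnerCLM ℝ (S y, y)).comp (S.prod (ContinuousLinearMap.id ℝ E))) y :=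
      S.hasFDerivAt.inner ℝ (hasFDerivAt_id y)
    refine (h1.const_mul (-(1 / 2 : ℝ))).congr_fderiv ?_
    ext v
    simp only [FunLike.coe_smul, Pi.smul_apply, ContinuousLinearMap.comp_apply,
      ContinuousLinearMap.prod_apply, ContinuousLinearMap.id_apply, fderivInnerCLM_apply,
      map_neg, FunLike.coe_neg, Pi.neg_apply, InnerProductSpace.toDual_apply_apply,
      smul_eq_mul]
    rw [hsymm v y, real_inner_comm (S y) v]
    ring
  refine ⟨M.contDiff, ?_, ?_, ?_⟩
  · exact contDiff_const.mul (S.contDiff.inner ℝ contDiff_id)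
  · intro y
    rw [(hgrad y).gradient, M.fderiv, sub_zero, hS_def]
    simp only [FunLike.coe_add, Pi.add_apply, ContinuousLinearMap.comp_apply, map_add,
      map_smul]
    module
  · intro y
    simp only [VectorCalculus.divergence, M.fderiv]
    exact htr

/-- **Energy of a linear profile scales like `L^{N+2}`**: `∫_{|y|<L} |My|² dy = L^{N+2} ∫_{|y|<1} |My|² dy`
(`N = dim E`), by the substitution `y = Lx`. This is the computation behind "linear solutions …
violate the energy bound (1.6)" (`∫_{|y|<L}|v|² ≲ L^{N−2α}`). [cite: BronziShvydkoy2015, §1 eq. (1.9) and (1.6)] -/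
theorem setIntegral_ball_normSq_linear [MeasurableSpace E] [BorelSpace E] (M : E →L[ℝ] E)
    {L : ℝ} (hL : 0 < L) :
    ∫ y in ball (0 : E) L, ‖M y‖ ^ 2 =
      L ^ (Module.finrank ℝ E + 2) * ∫ y in ball (0 : E) 1, ‖M y‖ ^ 2 := by
  have hsub := Measure.setIntegral_comp_smul_of_pos (volume : Measure E)
    (fun y : E => ‖M y‖ ^ 2) (ball (0 : E) 1) hL
  -- left side of `hsub`: `∫_{B_1} ‖M (L • x)‖² = L² ∫_{B_1} ‖M x‖²`
  have hlhs : ∫ x in ball (0 : E) 1, ‖M (L • x)‖ ^ 2 = L ^ 2 * ∫ x in ball (0 : E) 1, ‖M x‖ ^ 2 := by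
    rw [← integral_const_mul]
    refine setIntegral_congr_fun measurableSet_ball fun x _ => ?_
    rw [map_smul, norm_smul, mul_pow, Real.norm_of_nonneg hL.le]
  have hball : L • ball (0 : E) 1 = ball (0 : E) L := by
    rw [smul_unitBall hL.ne', Real.norm_of_nonneg hL.le]
  rw [hlhs, hball, smul_eq_mul] at hsub
  have hLn : 0 < L ^ Module.finrank ℝ E := pow_pos hL _
  rw [pow_add, mul_comm (L ^ Module.finrank ℝ E), mul_assoc]
  field_simp at hsub
  linarith [hsub]

/-- **Linear profiles cannot be part of a locally self-similar blow-up** (BS15, after (1.9):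
"these cannot be a part of locally self-similar blow-up as they violate the energy bound (1.6)"),
kernel form for the three-dimensional Beale–Kato–Majda class: if a classical finite-energy Euler
solution on `[0,T)` with bounded Sobolev norms on every `[0,T'']`, `T'' < T`, is locally
self-similar on a ball, `u(x,t) = (T−t)^{−α/(1+α)} v((x − x₀)(T−t)^{−1/(1+α)})`, `α > −1`, with a
LINEAR profile `v = M`, then `M = 0`. Proof: the profile obeys the energy bound (1.6)
`∫_{|y|<L}|v|² ≤ C L^{3−2α}` (`energyGrowth_of_locallySelfSimilar`), whereas for `M ≠ 0`
`∫_{|y|<L}|My|² = c L^5` with `c > 0` (`setIntegral_ball_normSq_linear`), and `5 > 3 − 2α`.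
No trace or symmetry condition on `M` is needed for this direction.
[cite: BronziShvydkoy2015, §1 eq. (1.9) and (1.6)] -/
theorem eq_zero_of_locallySelfSimilar_linear {T α ρ₀ : ℝ} {x₀ : EuclideanSpace ℝ (Fin 3)}
    {u : ℝ → EuclideanSpace ℝ (Fin 3) → EuclideanSpace ℝ (Fin 3)}
    {p : ℝ → EuclideanSpace ℝ (Fin 3) → ℝ}
    (M : EuclideanSpace ℝ (Fin 3) →L[ℝ] EuclideanSpace ℝ (Fin 3))
    (hT : 0 < T) (hα : -1 < α) (hρ₀ : 0 < ρ₀)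
    (hsol : IsClassicalEulerSolutionOn (Ico 0 T) 0 u p)
    (hreg : ∀ T'' < T, HasBoundedSobolevNormsOn (Icc 0 T'') u)
    (hss : ∀ t ∈ Ico 0 T, ∀ x ∈ ball x₀ ρ₀,
      u t x = selfSimilarCollapse (1 / (α + 1)) T (fun y => M y) t (x - x₀)) :
    M = 0 := by
  by_contra hM
  obtain ⟨x₁, hx₁⟩ : ∃ x, M x ≠ 0 := by
    by_contra h
    push Not at h
    exact hM (ContinuousLinearMap.ext fun x => by simp [h x])
  set I₁ := ∫ y in ball (0 : EuclideanSpace ℝ (Fin 3)) 1, ‖M y‖ ^ 2 with hI₁_def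
  have hI₁ : 0 < I₁ := by
    -- the integrand is continuous, nonnegative, and nonzero at a point of the unit ball
    set x₂ : EuclideanSpace ℝ (Fin 3) := (2 * (‖x₁‖ + 1))⁻¹ • x₁ with hx₂_def
    have hx₂_mem : x₂ ∈ ball (0 : EuclideanSpace ℝ (Fin 3)) 1 := by
      rw [mem_ball_zero_iff, hx₂_def, norm_smul, norm_inv, Real.norm_of_nonneg (by positivity),
        inv_mul_lt_iff₀ (by positivity)]
      linarith [norm_nonneg x₁]
    have hx₂ : M x₂ ≠ 0 := by
      rw [hx₂_def, map_smul]
      exact smul_ne_zero (inv_ne_zero (by positivity)) hx₁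
    have hcont : Continuous fun y : EuclideanSpace ℝ (Fin 3) => ‖M y‖ ^ 2 := by fun_prop
    have hint : IntegrableOn (fun y : EuclideanSpace ℝ (Fin 3) => ‖M y‖ ^ 2) (ball 0 1) volume :=
      (hcont.continuousOn.integrableOn_compact (isCompact_closedBall 0 1)).mono_set
        ball_subset_closedBall
    rw [hI₁_def, setIntegral_pos_iff_support_of_nonneg_ae
      (Eventually.of_forall fun y => by simp only [Pi.zero_apply]; positivity) hint]
    have hopen : IsOpen ({y : EuclideanSpace ℝ (Fin 3) | ‖M y‖ ^ 2 ≠ 0} ∩ ball 0 1) :=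
      (isOpen_ne_fun hcont continuous_const).inter isOpen_ball
    exact hopen.measure_pos volume ⟨x₂, by simpa using hx₂, hx₂_mem⟩
  -- the energy bound (1.6) along the collapse against the scaling law `E(L) = L⁵ I₁`
  set K := (∫ x, ‖u 0 x‖ ^ 2) * ρ₀ ^ (2 * α - 3) with hK_def
  set L₀ := ρ₀ * T ^ (-(1 / (α + 1))) with hL₀_def
  have hbound : ∀ L, L₀ ≤ L → 1 ≤ L → I₁ ≤ K * L ^ (-(2 + 2 * α)) := by
    intro L hL hL1
    have hLpos : 0 < L := by linarith
    have h1 := energyGrowth_of_locallySelfSimilar hT hα hρ₀ hsol hreg hss hL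
    rw [setIntegral_ball_normSq_linear M hLpos, finrank_euclideanSpace_fin] at h1
    have hL5 : (0 : ℝ) < L ^ (3 + 2) := pow_pos hLpos _
    have h2 : I₁ ≤ K * L ^ (3 - 2 * α) / L ^ (3 + 2) := by
      rw [le_div_iff₀ hL5, mul_comm]
      exact h1
    refine h2.trans_eq ?_
    rw [show L ^ (3 + 2) = L ^ ((5 : ℕ) : ℝ) by rw [Real.rpow_natCast], mul_div_assoc,
      ← Real.rpow_sub hLpos]
    congr 2
    push_cast
    ring
  have htend : Tendsto (fun L : ℝ => K * L ^ (-(2 + 2 * α))) atTop (𝓝 (K * 0)) :=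
    (tendsto_rpow_neg_atTop (by linarith)).const_mul K
  rw [mul_zero] at htend
  obtain ⟨L, hlt, hL, hL1⟩ :=
    ((htend.eventually (gt_mem_nhds hI₁)).and
      ((eventually_ge_atTop L₀).and (eventually_ge_atTop 1))).exists
  exact lt_irrefl _ ((hbound L hL hL1).trans_lt hlt)

end LinearProfiles

end Literature.Analysis.FluidPDE

end
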